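import Summits.QuantumFields.BalabanUV.Beta.GAN24.InsertionWordTwoPointDecay

/-!
# `BalabanUV.Beta.GAN24.KingWeightTwoLevel` — binder row G-an2-4 ∕ (CONV-C), routes C-R6° («VALUES») × R7 («TWO CURRENCIES»), PART 201:
# THE CANONICAL COMBES–THOMAS WEIGHT ACROSS ONE AVERAGING STEP, AND THE TENT PROFILE — `|ρ_{k+1,y}(u′) − ρ_{k,y}(par u′)| ≤ 1∕n_k` FOR EVERY FINE BOND `u′` OF LEVEL `k+1`,
# HENCE THE LOCALISED BACKGROUND `V^{(k)}_μ(u) = [μ = x₂]·max(−ρ_{k,x}(u), 0)` IS A `LipschitzBackground … 1 1` SUPPORTED WHERE `ρ_{k,x} ≤ 0` — the NON-VACUITY of the class of leg data of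
# PART 200 (`conv_oneLoop_loopCov_insertionLegs`: localised Lipschitz families) beyond `V ≡ 0`.  NE2's `CTKingTowerWeights` compares `ρ_{k,y}` with the UNIT-lattice block distance
# (`tdist_ctr_bounds`, slack `(n_k − 1)∕n_k` — enough for Lipschitz-at-own-spacing and the block oscillation, NOT for two-spacing consistency, which needs slack `O(1∕n_k)`); this file
# compares TWO ADJACENT LEVELS: `L·tdist_k(ctr_k y, par u′) − (L−1) ≤ tdist_{k+1}(ctr_{k+1} y, u′) ≤ L·tdist_k(ctr_k y, par u′) + (L−1)` — coordinatewise the fine coordinate is `a = Lp + j`,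
# `0 ≤ j < L`, the centres are `L·n_k·y` and `n_k·y`, and a circular distance `min(δ, N − δ)` moves by at most `j` when `δ` does (unit b2b-balaban-gan24-p3, gen 62; v1)

NOT IN PRINT; OUR PROOF ([folklore] `ZMod.val` arithmetic over NE2's `CTKingTowerWeights` (`ctr`, `rhoSite`, `rho`, `abs_rho_fineStep_le`), `BalabanAveragedTowerModes.val_par`, `B5Blocks16.bpt_val`,
the β-cell's `VectorTailsCov.tdist` ∕ `VectorTails.liftZ` ∕ `PoissonInterior.supNorm`, Mathlib's `ZMod.valMinAbs_natAbs_eq_min` ∕ `ZMod.val_sub` ∕ `ZMod.val_neg_of_ne_zero` ∕ `abs_max_sub_max_le_abs`;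
NE2's `FirstOrderBackgroundModel.LipschitzBackground` is the STRUCTURE being instantiated; nothing printed is a hypothesis).
HONEST FRAMING (cell contract, verbatim): «discharging `BetaPertH` makes Bałaban's UV stability UNCONDITIONAL — a real constructive-QFT result; it is NOT the
continuum limit and NOT the Clay problem.»  HONEST DEPENDENCY (verbatim): «continuum YM on T⁴ ⇐ BetaPertH ∧ nine spine estimates (0/9 proved); BetaPertH ⇐
(D1) ∧ (D4) ∧ CAP+tail; G-an2-4 gates asym, D1 and NE2/3/4.»

WHAT THIS FILE PROVES (0 sorry, 0 `def`; `n_k = lev L k`, `ctr_k y = bpt n_k M (toM y) 0`, `ρ_{k,y}(u) = tdist(ctr_k y, u₁)∕n_k − 1`, `par = BalabanAveragedTowerModes.par n_k L M`; the tent profile is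
DISPLAYED as a hypothesis `∀ k μ u, V k μ u = [μ = x₂]·max(−ρ_{k,x}(u), 0)`, no definition introduced):
* §1 (arithmetic) `natAbs_sub_le_of_lt`; **`circ_scale`** (`a < LN`, `c < N`: the circular distances `D′ = min(|a − Lc|, LN − |a − Lc|)` and `D = min(|⌊a∕L⌋ − c|, N − |⌊a∕L⌋ − c|)` satisfy
  `D′ ≤ L·D + (L−1)` and `L·D ≤ D′ + (L−1)`); **`natAbs_valMinAbs_sub`** (`|liftZ(A − B)| = min(|v(A) − v(B)|, N − |v(A) − v(B)|)` in `ℤ∕N`); `mul_sup_le_sup_add`.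
* §2 `val_ctr`; **`tdist_ctr_succ_bounds`** — `tdist_{k+1}(ctr_{k+1} y, u′) ≤ L·tdist_k(ctr_k y, par u′) + (L−1)` and `L·tdist_k(ctr_k y, par u′) ≤ tdist_{k+1}(ctr_{k+1} y, u′) + (L−1)`;
  **`abs_rhoSite_succ_sub_le`** — `|ρ_{k+1,y}(u′) − ρ_{k,y}(par u′)| ≤ 1∕n_k` (the two-spacing consistency of the canonical weight).
* §3 `neg_one_le_rho`; **`lipschitzBackground_tent`** — the tent profile about ANY unit bond `x` is a `LipschitzBackground L M V 1 1` (size ≤ 1; Lipschitz at its own spacing by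
  `abs_rho_fineStep_le`; two-spacing consistent by §2; `max(·,0)` is 1-Lipschitz); **`rho_nonpos_of_tent_ne_zero`** — it is supported where `ρ_{k,x} ≤ 0` (`c₀ = 0` in PART 198 ∕ 200).
WHAT IT DOES NOT DO: the pointwise limits of the tent family about integer roots along the socket volumes and the END instance (PART 202); other profiles (any `1`-Lipschitz function of
`ρ_{k,x}` vanishing for `ρ ≥ c₀` works verbatim); the indicator `1_{block x}` (not Lipschitz at its own spacing).  SUPPLIER work; NEVER «G-an2-4 closed»; NOT (CONV-C), NOT D1, NOT
`BetaPertH`, NOT continuum, NOT Clay.  Records: `HOME/b2b-balaban-gan24-p3/gen62/README.md`.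
-/

noncomputable section

open scoped BigOperators ComplexConjugate
open Filter Topology Finset

namespace Summit.QuantumFields.BalabanUV.Beta.GAN24.KingWeightTwoLevel

open Literature.MathematicalPhysics.QuantumFieldTheory.Balaban1983to89
open Literature.MathematicalPhysics.QuantumFieldTheory.Balaban1983to89.B5Prop11Plancherel (Tor fine unitVec)
open Literature.MathematicalPhysics.QuantumFieldTheory.Balaban1983to89.B5Block118 (bpt)
open Literature.MathematicalPhysics.QuantumFieldTheory.Balaban1983to89.B5Blocks16 (bpt_val)
open Literature.MathematicalPhysics.QuantumFieldTheory.Balaban1983to89.B5G183RateUnitTower (lev)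
open Literature.MathematicalPhysics.QuantumFieldTheory.Balaban1983to89.Beta.VectorTails (liftZ)
open Literature.MathematicalPhysics.QuantumFieldTheory.Balaban1983to89.Beta.VectorTailsCov (tdist)
open Literature.MathematicalPhysics.QuantumFieldTheory.Balaban1983to89.Beta.PoissonInterior (supNorm)
open Summit.QuantumFields.BalabanUV.T4Continuum
open Summit.QuantumFields.BalabanUV.T4Continuum.BalabanAveragedTowerModes (par val_par)
open Summit.QuantumFields.BalabanUV.T4Continuum.BalabanAveragedTowerUnit (idx lev_succ' one_le_lev')
open Summit.QuantumFields.BalabanUV.T4Continuum.CTKingTowerWeights (rho rhoSite ctr toM rho_apply abs_rho_fineStep_le)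
open Summit.QuantumFields.BalabanUV.T4Continuum.BlockPairingGeometry (tau parT)
open Summit.QuantumFields.BalabanUV.T4Continuum.FirstOrderBackgroundModel (LipschitzBackground)

/-! ## §1 Arithmetic: circular distances across a scaling by `L` -/

section Arith

/-- `|p − c| ≤ N` for `p, c < N` (as naturals under the integer cast). [folklore] -/
theorem natAbs_sub_le_of_lt {p c N : ℕ} (hp : p < N) (hc : c < N) : Int.natAbs ((p : ℤ) - c) ≤ N := by
  rcases Nat.lt_or_ge p c with h | h
  · rw [Int.natAbs_natCast_sub_natCast_of_le h.le]; omega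
  · rw [Int.natAbs_natCast_sub_natCast_of_ge h]; omega

/-- **`circ_scale` — A CIRCULAR DISTANCE ACROSS A SCALING BY `L`** [folklore] (`L ≥ 1`, `a < LN`, `c < N`): with `D′ = min(|a − Lc|, LN − |a − Lc|)` (the distance of `a` and `Lc` on `ℤ∕LN`) and
`D = min(|⌊a∕L⌋ − c|, N − |⌊a∕L⌋ − c|)` (the distance of `⌊a∕L⌋` and `c` on `ℤ∕N`): `D′ ≤ L·D + (L−1)` and `L·D ≤ D′ + (L−1)` — `a = L⌊a∕L⌋ + j`, `0 ≤ j ≤ L − 1`. -/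
theorem circ_scale {L N a c : ℕ} (hL : 1 ≤ L) (ha : a < L * N) (hc : c < N) :
    min (Int.natAbs ((a : ℤ) - (L * c : ℕ))) (L * N - Int.natAbs ((a : ℤ) - (L * c : ℕ)))
      ≤ L * min (Int.natAbs (((a / L : ℕ) : ℤ) - c)) (N - Int.natAbs (((a / L : ℕ) : ℤ) - c)) + (L - 1) ∧
    L * min (Int.natAbs (((a / L : ℕ) : ℤ) - c)) (N - Int.natAbs (((a / L : ℕ) : ℤ) - c))
      ≤ min (Int.natAbs ((a : ℤ) - (L * c : ℕ))) (L * N - Int.natAbs ((a : ℤ) - (L * c : ℕ))) + (L - 1) := by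
  have hL0 : 0 < L := hL
  have hpj : a = L * (a / L) + a % L := (Nat.div_add_mod a L).symm
  have hj : a % L < L := Nat.mod_lt a hL0
  have hpN : a / L < N := Nat.div_lt_of_lt_mul ha
  have e1 : ((a : ℤ) - (L * c : ℕ)) = (L : ℤ) * (((a / L : ℕ) : ℤ) - c) + (a % L : ℕ) := by
    conv_lhs => rw [hpj]
    push_cast; ring
  have F1 : Int.natAbs ((a : ℤ) - (L * c : ℕ)) ≤ L * Int.natAbs (((a / L : ℕ) : ℤ) - c) + a % L := by
    rw [e1]
    calc ((L : ℤ) * (((a / L : ℕ) : ℤ) - c) + (a % L : ℕ)).natAbs ≤ ((L : ℤ) * (((a / L : ℕ) : ℤ) - c)).natAbs + ((a % L : ℕ) : ℤ).natAbs :=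
          Int.natAbs_add_le _ _
      _ = L * Int.natAbs (((a / L : ℕ) : ℤ) - c) + a % L := by rw [Int.natAbs_mul, Int.natAbs_natCast, Int.natAbs_natCast]
  have F2 : L * Int.natAbs (((a / L : ℕ) : ℤ) - c) ≤ Int.natAbs ((a : ℤ) - (L * c : ℕ)) + a % L := by
    have e2 : (L : ℤ) * (((a / L : ℕ) : ℤ) - c) = ((a : ℤ) - (L * c : ℕ)) - (a % L : ℕ) := by rw [e1]; ring
    have : ((L : ℤ) * (((a / L : ℕ) : ℤ) - c)).natAbs ≤ Int.natAbs ((a : ℤ) - (L * c : ℕ)) + a % L := by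
      rw [e2]; exact (Int.natAbs_sub_le _ _).trans (by rw [Int.natAbs_natCast])
    rwa [Int.natAbs_mul, Int.natAbs_natCast] at this
  have F3 : Int.natAbs (((a / L : ℕ) : ℤ) - c) ≤ N := natAbs_sub_le_of_lt hpN hc
  have F4 : Int.natAbs ((a : ℤ) - (L * c : ℕ)) ≤ L * N := natAbs_sub_le_of_lt ha (Nat.mul_lt_mul_of_pos_left hc hL0)
  have hT : L * Int.natAbs (((a / L : ℕ) : ℤ) - c) ≤ L * N := Nat.mul_le_mul_left L F3
  have hmin : L * min (Int.natAbs (((a / L : ℕ) : ℤ) - c)) (N - Int.natAbs (((a / L : ℕ) : ℤ) - c))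
      = min (L * Int.natAbs (((a / L : ℕ) : ℤ) - c)) (L * N - L * Int.natAbs (((a / L : ℕ) : ℤ) - c)) := by
    rw [← Nat.mul_min_mul_left, Nat.mul_sub]
  rw [hmin]
  generalize Int.natAbs ((a : ℤ) - (L * c : ℕ)) = D' at F1 F2 F4 ⊢
  generalize Int.natAbs (((a / L : ℕ) : ℤ) - c) = D at F1 F2 F3 hT ⊢
  generalize a % L = j at hj F1 F2
  constructor <;> omega

/-- **the centred lift of a difference in `ℤ∕N` is the circular distance of the residues**: `|liftZ(A − B)| = min(|v(A) − v(B)|, N − |v(A) − v(B)|)`. [folklore] -/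
theorem natAbs_valMinAbs_sub (N : ℕ) [NeZero N] (A B : ZMod N) :
    ((A - B).valMinAbs).natAbs = min (Int.natAbs ((A.val : ℤ) - B.val)) (N - Int.natAbs ((A.val : ℤ) - B.val)) := by
  rw [ZMod.valMinAbs_natAbs_eq_min]
  have hA := A.val_lt; have hB := B.val_lt
  rcases Nat.lt_or_ge A.val B.val with h | h
  · have hne : B - A ≠ 0 := fun h0 => by rw [sub_eq_zero] at h0; rw [h0] at h; exact lt_irrefl _ h
    haveI : NeZero (B - A) := ⟨hne⟩
    rw [show A - B = -(B - A) by ring, ZMod.val_neg_of_ne_zero, ZMod.val_sub h.le, Int.natAbs_natCast_sub_natCast_of_le h.le]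
    omega
  · rw [ZMod.val_sub h, Int.natAbs_natCast_sub_natCast_of_ge h]

/-- `L·sup f ≤ sup g + c` from `L·f i ≤ g i + c` coordinatewise (finite sup over `Fin d`; the empty case is `0 ≤ c`). [folklore] -/
theorem mul_sup_le_sup_add {d : ℕ} (f g : Fin d → ℕ) (L c : ℕ) (h : ∀ i, L * f i ≤ g i + c) : L * univ.sup f ≤ univ.sup g + c := by
  by_cases hne : (univ : Finset (Fin d)).Nonempty
  · obtain ⟨i, -, hi⟩ := Finset.exists_mem_eq_sup univ hne f
    rw [hi]; exact (h i).trans (Nat.add_le_add_right (Finset.le_sup (mem_univ i)) c)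
  · rw [Finset.not_nonempty_iff_eq_empty.mp hne]; simp

end Arith

/-! ## §2 The canonical weight across one averaging step -/

section TwoLevel

variable {d : ℕ} (L : ℕ) [NeZero L] (M : Fin d → ℕ) [hM : ∀ μ, NeZero (M μ)]

/-- the fine coordinates of the centre `ctr_k y` (the corner of the block of `y` at level `k`): `v((ctr_k y)_ν) = n_k·v(y_ν)`. [folklore] -/
theorem val_ctr (k : ℕ) (y : idx L M 0) (ν : Fin d) : (ctr L M k y ν).val = lev L k * (toM L M y.1 ν).val := by
  show (bpt (lev L k) M (toM L M y.1) 0 ν).val = _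
  rw [bpt_val]
  simp

/-- **`tdist_ctr_succ_bounds` — THE FINE SUP-DISTANCE TO THE CENTRE ACROSS ONE AVERAGING STEP** [our proof] (`L ≥ 1`; `u′` a fine site of level `k+1`, `par u′` its parent of level `k`):
`tdist_{k+1}(ctr_{k+1} y, u′) ≤ L·tdist_k(ctr_k y, par u′) + (L−1)` and `L·tdist_k(ctr_k y, par u′) ≤ tdist_{k+1}(ctr_{k+1} y, u′) + (L−1)` — coordinatewise `circ_scale` with `a = v(u′_ν)`,
`c = n_k·v(y_ν)`, `N = n_kM_ν` (`v((par u′)_ν) = ⌊a∕L⌋`, `v((ctr_{k+1} y)_ν) = L·c`), then the sup over `ν`. -/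
theorem tdist_ctr_succ_bounds (hL : 1 ≤ L) (k : ℕ) (y : idx L M 0) (u' : Tor (fine (lev L (k + 1)) M)) :
    tdist (ctr L M (k + 1) y) u' ≤ L * tdist (ctr L M k y) (par (lev L k) L M u') + (L - 1) ∧
    L * tdist (ctr L M k y) (par (lev L k) L M u') ≤ tdist (ctr L M (k + 1) y) u' + (L - 1) := by
  have hn : 0 < lev L k := Nat.pos_of_ne_zero (NeZero.ne (lev L k))
  -- coordinatewise circular distances
  have hcoord : ∀ ν : Fin d,
      (liftZ (u' - ctr L M (k + 1) y) ν).natAbs ≤ L * (liftZ (par (lev L k) L M u' - ctr L M k y) ν).natAbs + (L - 1) ∧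
      L * (liftZ (par (lev L k) L M u' - ctr L M k y) ν).natAbs ≤ (liftZ (u' - ctr L M (k + 1) y) ν).natAbs + (L - 1) := by
    intro ν
    have hY : (toM L M y.1 ν).val < M ν := ZMod.val_lt _
    have hc : lev L k * (toM L M y.1 ν).val < lev L k * M ν := Nat.mul_lt_mul_of_pos_left hY hn
    have e2 : L * (lev L k * M ν) = fine (lev L (k + 1)) M ν := by show L * (lev L k * M ν) = L * lev L k * M ν; rw [Nat.mul_assoc]
    have e1 : L * (lev L k * (toM L M y.1 ν).val) = lev L (k + 1) * (toM L M y.1 ν).val := by rw [lev_succ', Nat.mul_assoc]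
    have ha : (u' ν).val < L * (lev L k * M ν) := (ZMod.val_lt (u' ν)).trans_eq e2.symm
    have h1 : (liftZ (u' - ctr L M (k + 1) y) ν).natAbs
        = min (Int.natAbs (((u' ν).val : ℤ) - (lev L (k + 1) * (toM L M y.1 ν).val : ℕ)))
            (fine (lev L (k + 1)) M ν - Int.natAbs (((u' ν).val : ℤ) - (lev L (k + 1) * (toM L M y.1 ν).val : ℕ))) := by
      show ((u' ν - ctr L M (k + 1) y ν).valMinAbs).natAbs = _
      rw [natAbs_valMinAbs_sub, val_ctr]
    have h2 : (liftZ (par (lev L k) L M u' - ctr L M k y) ν).natAbs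
        = min (Int.natAbs ((((u' ν).val / L : ℕ) : ℤ) - (lev L k * (toM L M y.1 ν).val : ℕ)))
            (fine (lev L k) M ν - Int.natAbs ((((u' ν).val / L : ℕ) : ℤ) - (lev L k * (toM L M y.1 ν).val : ℕ))) := by
      show ((par (lev L k) L M u' ν - ctr L M k y ν).valMinAbs).natAbs = _
      rw [natAbs_valMinAbs_sub, val_ctr, val_par]
      rfl
    have key := circ_scale (N := lev L k * M ν) (a := (u' ν).val) (c := lev L k * (toM L M y.1 ν).val) hL ha hc
    rw [e1, e2, show lev L k * M ν = fine (lev L k) M ν from rfl] at key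
    rw [h1, h2]
    exact key
  refine ⟨?_, ?_⟩
  · show univ.sup (fun ν => (liftZ (u' - ctr L M (k + 1) y) ν).natAbs) ≤ L * univ.sup (fun ν => (liftZ (par (lev L k) L M u' - ctr L M k y) ν).natAbs) + (L - 1)
    exact Finset.sup_le fun ν _ => (hcoord ν).1.trans
      (Nat.add_le_add_right (Nat.mul_le_mul_left L (Finset.le_sup (f := fun ν => (liftZ (par (lev L k) L M u' - ctr L M k y) ν).natAbs) (mem_univ ν))) _)
  · show L * univ.sup (fun ν => (liftZ (par (lev L k) L M u' - ctr L M k y) ν).natAbs) ≤ univ.sup (fun ν => (liftZ (u' - ctr L M (k + 1) y) ν).natAbs) + (L - 1)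
    exact mul_sup_le_sup_add _ _ L (L - 1) fun ν => (hcoord ν).2

/-- **`abs_rhoSite_succ_sub_le` — THE TWO-SPACING CONSISTENCY OF THE CANONICAL WEIGHT** [our proof] (`L ≥ 1`): `|ρ_{k+1,y}(u′) − ρ_{k,y}(par u′)| ≤ 1∕n_k` for every fine site `u′` of
level `k+1` — from `tdist_ctr_succ_bounds`: `|tdist_{k+1}∕(Ln_k) − tdist_k∕n_k| ≤ (L−1)∕(Ln_k) ≤ 1∕n_k`. -/
theorem abs_rhoSite_succ_sub_le (hL : 1 ≤ L) (k : ℕ) (y : idx L M 0) (u' : Tor (fine (lev L (k + 1)) M)) :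
    |rhoSite L M (k + 1) y u' - rhoSite L M k y (par (lev L k) L M u')| ≤ 1 / (lev L k : ℝ) := by
  obtain ⟨h1, h2⟩ := tdist_ctr_succ_bounds L M hL k y u'
  have hn : (0 : ℝ) < lev L k := by exact_mod_cast Nat.pos_of_ne_zero (NeZero.ne (lev L k))
  have hL0 : (0 : ℝ) < L := by exact_mod_cast hL
  have hL1 : ((L - 1 : ℕ) : ℝ) = (L : ℝ) - 1 := by rw [Nat.cast_sub hL, Nat.cast_one]
  have h1' : (tdist (ctr L M (k + 1) y) u' : ℝ) ≤ L * (tdist (ctr L M k y) (par (lev L k) L M u') : ℝ) + ((L : ℝ) - 1) := by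
    rw [← hL1]; exact_mod_cast h1
  have h2' : (L : ℝ) * (tdist (ctr L M k y) (par (lev L k) L M u') : ℝ) ≤ (tdist (ctr L M (k + 1) y) u' : ℝ) + ((L : ℝ) - 1) := by
    rw [← hL1]; exact_mod_cast h2
  have hkey : |(tdist (ctr L M (k + 1) y) u' : ℝ) - L * (tdist (ctr L M k y) (par (lev L k) L M u') : ℝ)| ≤ L :=
    abs_sub_le_iff.mpr ⟨by linarith, by linarith⟩
  have e4 : ((lev L (k + 1) : ℕ) : ℝ) = (L : ℝ) * (lev L k : ℝ) := by rw [lev_succ', Nat.cast_mul]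
  unfold rhoSite
  rw [e4]
  rw [show (tdist (ctr L M (k + 1) y) u' : ℝ) / ((L : ℝ) * (lev L k : ℝ)) - 1 - ((tdist (ctr L M k y) (par (lev L k) L M u') : ℝ) / (lev L k : ℝ) - 1)
      = ((tdist (ctr L M (k + 1) y) u' : ℝ) - L * (tdist (ctr L M k y) (par (lev L k) L M u') : ℝ)) / ((L : ℝ) * (lev L k : ℝ)) by
    field_simp; ring, abs_div, abs_of_pos (mul_pos hL0 hn)]
  calc |(tdist (ctr L M (k + 1) y) u' : ℝ) - L * (tdist (ctr L M k y) (par (lev L k) L M u') : ℝ)| / ((L : ℝ) * (lev L k : ℝ))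
      ≤ (L : ℝ) / ((L : ℝ) * (lev L k : ℝ)) := div_le_div_of_nonneg_right hkey (mul_pos hL0 hn).le
    _ = 1 / (lev L k : ℝ) := by field_simp

end TwoLevel

/-! ## §3 The tent profile is a localised Lipschitz background -/

section Tent

variable {d : ℕ} (L : ℕ) [NeZero L] (M : Fin d → ℕ) [hM : ∀ μ, NeZero (M μ)]

omit hM in
/-- `ρ_{k,y} ≥ −1` (it is a distance over `n_k`, minus one). [folklore] -/
theorem neg_one_le_rho (k : ℕ) (y : idx L M 0) (u : idx L M k) : -1 ≤ rho L M k y u := by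
  rw [rho_apply]
  unfold rhoSite
  have : 0 ≤ (tdist (ctr L M k y) u.1 : ℝ) / (lev L k : ℝ) := by positivity
  linarith

/-- **`lipschitzBackground_tent` — THE TENT PROFILE ABOUT ANY UNIT BOND IS A LOCALISED LIPSCHITZ BACKGROUND** [our proof] (`L ≥ 1`; the profile DISPLAYED as a hypothesis on `V`, no
definition): `V^{(k)}_μ(u) = [μ = x₂]·max(−ρ_{k,x}(u), 0)` satisfies NE2's `LipschitzBackground L M V 1 1` — size `≤ 1` (`ρ ≥ −1`), Lipschitz at its own spacing (`|ρ(u + e_ν) − ρ(u)| ≤ 1∕n_k`,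
`abs_rho_fineStep_le`, and `max(·, 0)` is 1-Lipschitz), two-spacing consistent (`abs_rhoSite_succ_sub_le`). -/
theorem lipschitzBackground_tent (hL : 1 ≤ L) (x : idx L M 0) {V : (k : ℕ) → Fin d → (idx L M k → ℂ)}
    (hV : ∀ k μ u, V k μ u = if μ = x.2 then (((max (-rho L M k x u) 0 : ℝ)) : ℂ) else 0) : LipschitzBackground L M V 1 1 where
  nonneg := ⟨zero_le_one, zero_le_one⟩
  bound := fun k μ u => by
    rw [hV]
    split_ifs
    · rw [Complex.norm_real, Real.norm_eq_abs, abs_of_nonneg (le_max_right _ _)]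
      exact max_le (by have := neg_one_le_rho L M k x u; linarith) zero_le_one
    · simp
  lipschitz := fun k μ ν i => by
    rw [hV, hV]
    show ‖(if μ = x.2 then (((max (-rho L M k x (i.1 + unitVec (fine (lev L k) M) ν, i.2)) 0 : ℝ)) : ℂ) else 0)
        - (if μ = x.2 then (((max (-rho L M k x i) 0 : ℝ)) : ℂ) else 0)‖ ≤ 1 / (lev L k : ℝ)
    split_ifs
    · rw [← Complex.ofReal_sub, Complex.norm_real, Real.norm_eq_abs]
      calc |max (-rho L M k x (i.1 + unitVec (fine (lev L k) M) ν, i.2)) 0 - max (-rho L M k x i) 0|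
          ≤ |-rho L M k x (i.1 + unitVec (fine (lev L k) M) ν, i.2) - -rho L M k x i| := abs_max_sub_max_le_abs _ _ _
        _ = |rho L M k x (i.1 + unitVec (fine (lev L k) M) ν, i.2) - rho L M k x i| := by rw [neg_sub_neg, abs_sub_comm]
        _ ≤ 1 / (lev L k : ℝ) := abs_rho_fineStep_le L M k x i.1 i.2 ν
    · simp
  consistent := fun k μ i => by
    rw [hV, hV]
    show ‖(if μ = x.2 then (((max (-rho L M (k + 1) x i) 0 : ℝ)) : ℂ) else 0)
        - (if μ = x.2 then (((max (-rho L M k x (par (lev L k) L M i.1, i.2)) 0 : ℝ)) : ℂ) else 0)‖ ≤ 1 / (lev L k : ℝ)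
    split_ifs
    · rw [← Complex.ofReal_sub, Complex.norm_real, Real.norm_eq_abs]
      calc |max (-rho L M (k + 1) x i) 0 - max (-rho L M k x (par (lev L k) L M i.1, i.2)) 0|
          ≤ |-rho L M (k + 1) x i - -rho L M k x (par (lev L k) L M i.1, i.2)| := abs_max_sub_max_le_abs _ _ _
        _ = |rhoSite L M (k + 1) x i.1 - rhoSite L M k x (par (lev L k) L M i.1)| := by rw [neg_sub_neg, abs_sub_comm, rho_apply, rho_apply]
        _ ≤ 1 / (lev L k : ℝ) := abs_rhoSite_succ_sub_le L M hL k x i.1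
    · simp

omit hM in
/-- **`rho_nonpos_of_tent_ne_zero` — THE TENT PROFILE IS SUPPORTED WHERE `ρ_{k,x} ≤ 0`** (the localisation hypothesis of PART 198 ∕ 200 with `c₀ = 0`). [folklore] -/
theorem rho_nonpos_of_tent_ne_zero [∀ μ, NeZero (M μ)] (x : idx L M 0) {V : (k : ℕ) → Fin d → (idx L M k → ℂ)}
    (hV : ∀ k μ u, V k μ u = if μ = x.2 then (((max (-rho L M k x u) 0 : ℝ)) : ℂ) else 0) (k : ℕ) (μ : Fin d) (u : idx L M k)
    (h : V k μ u ≠ 0) : rho L M k x u ≤ 0 := by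
  rw [hV] at h
  split_ifs at h with hμ
  · have h' : (max (-rho L M k x u) 0 : ℝ) ≠ 0 := fun h0 => h (by rw [h0, Complex.ofReal_zero])
    have hpos : 0 < max (-rho L M k x u) 0 := lt_of_le_of_ne (le_max_right _ _) (Ne.symm h')
    rcases lt_max_iff.mp hpos with h1 | h1
    · linarith
    · exact (lt_irrefl _ h1).elim
  · exact (h rfl).elim

end Tent

end Summit.QuantumFields.BalabanUV.Beta.GAN24.KingWeightTwoLevel

end
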